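import Literature.MathematicalPhysics.QuantumLattice.FermiRG.Salmhofer1998ComponentRGE
import Literature.MathematicalPhysics.QuantumLattice.GrassmannCumulantFlow
import Literature.Probability.LatticeModels.CumulantsAnalytic
import HarnessLib

/-!
# Salmhofer 1998, §3 end to end: the perturbative effective action solves the component RGE `\icomRGE`
# in F7b's typed form (`IsRGESolution`) — PROVED, unconditionally

Theorem-only companion (kind `proof`: no definition, no named fact, no `instance`, no `notation`, no `sorry`) of
F7am `Salmhofer1998ComponentRGE.lean` (`isRGESolution_of_orderwise_rge`: ANY even solution family of the RGE at
order `λ^r` with Wick kernels of bounded degree gives an F7b `IsRGESolution`) and of the generic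
`GrassmannCumulantFlow.lean` (`hasCoeffDerivAt_orderwise_effAction`: the perturbative effective action
`𝒢_r = (r!)⁻¹ 𝓔ᵀ_{C_t}(W; r)` DOES solve the RGE at order `λ^r`).  Composing the two discharges the hypotheses
`heven` / `hflow` / `hdeg` of F7am for the actual objects of M. Salmhofer, Commun. Math. Phys. 194 (1998) 249, §3:

* `transpose_dotCov_eq_neg` — if `D_t = C_∞ - C_t` is antisymmetric for all `t` (the covariance of the
  unintegrated fields, render p0011:L159-L165) and `C` is entrywise differentiable, then `Ċ_t` is antisymmetric
  (uniqueness of derivatives);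
* **`isRGESolution_orderwise_effAction`** — for `t ↦ C_t` entrywise `C¹` (derivative `Ċ_t`, continuous),
  `C_∞ - C_t` antisymmetric, `W ∈ ⋀^{even} 𝒜` ANY even interaction and `𝒢_r(t) = (r!)⁻¹ · cumulantOf
  (k ↦ e^{Δ_{C_t}} W^k) r` (`r ≥ 1`, `𝒢_0 = 0`; the coefficient of `λ^r` in `𝒢(t,ψ) = log e^{Δ_{C_t}} e^{λW}`,
  p0011:L46-L53, L143-L150 — the truncated expectations whose kernels are the tree's `effAction` by
  `kernel_effAction_eq_neg_tsum`), the `ε`-scaled Wick-ordered kernels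
  `G_{m,r}(t | X) = -ε^{-m} · wickKernel (C_∞ - C_t) (𝒢_r t) m X` (the `G_{mr}(t|X)` of p0011:L167-L175 in the
  tree's sign/weight dictionary of F7am) satisfy F7b's `IsRGESolution ε m̄ (C - C_∞) Ċ G` for every `ε ≠ 0`,
  with the degree bound `m̄(r) = |Γ|` (a kernel with more than `|Γ|` legs has a repeated label and vanishes,
  F7am `wickKernel_eq_zero_of_not_injective`).

`IsRGESolution` (F7b `Salmhofer1998Sec2.lean`) is the integral form of the component RGE `\icomRGE`
(p0012:L152-L160) with the bilinear term (4.3) (p0014:L44-L52); F7b's Theorems 1–3 are typed for an arbitrary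
`m̄`, so the present `m̄ = |Γ|` closes the bridge; the model-specific support bound `m̄(r) = 2r + 2` for a quartic
`V` (p0011:L172, "`m̄(r)`") is the tree's `kernel_cumulantOf_eq_zero_of_degree_lt` (BGM 2006 (2.13)) and is not
restated here.  The `𝒱 = -𝒢` convention of F7am `isRGESolution_of_orderwise_rge_neg` gives the same kernel
family (`wickKernel` is linear), so no second statement is needed.

## References

M. Salmhofer, Commun. Math. Phys. 194 (1998) 249–295, §3.1–3.2, §4.1 (`Salmhofer1998`; render
`paper-arxiv-cond-mat_9706188` p0011, p0012, p0014).
-/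

noncomputable section

namespace Literature.MathematicalPhysics.QuantumLattice.FermiRG

namespace Salmhofer1998

open GrassmannAlgebra Finset Literature.Probability.LatticeModels
open scoped Nat

section DotCov

variable {Γ : Type*}

/-- **The derivative of an antisymmetric covariance family is antisymmetric**: if `D_t = C_∞ - C_t` is
antisymmetric for every `t` and `C` is entrywise differentiable with derivative `Ċ_t`, then `Ċ_tᵀ = -Ċ_t`
(uniqueness of derivatives). [cite: Salmhofer1998, §3.2 (render p0011:L159-L165)] -/
theorem transpose_dotCov_eq_neg (C : ℝ → Matrix Γ Γ ℂ) (Cdot : ℝ → Matrix Γ Γ ℂ) (Cinf : Matrix Γ Γ ℂ)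
    (hC : ∀ (t : ℝ) (X Y : Γ), HasDerivAt (fun s => C s X Y) (Cdot t X Y) t)
    (hanti : ∀ t : ℝ, (Cinf - C t).transpose = -(Cinf - C t)) (t : ℝ) :
    (Cdot t).transpose = -Cdot t := by
  ext X Y
  rw [Matrix.transpose_apply, Matrix.neg_apply]
  have hfun : (fun s => C s Y X) = fun s => (Cinf Y X + Cinf X Y) - C s X Y := funext fun s => by
    have h := congrFun (congrFun (hanti s) X) Y
    simp only [Matrix.transpose_apply, Matrix.neg_apply, Matrix.sub_apply] at h
    linear_combination -h
  have h1 : HasDerivAt (fun s => C s Y X) (-Cdot t X Y) t := by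
    rw [hfun]
    exact (hC t X Y).const_sub _
  exact (hC t Y X).unique h1

end DotCov

section Homogeneity

/-- **Cumulants are homogeneous**: scaling the moments `μ_k ↦ c^k μ_k` (i.e. the variable `X ↦ cX`) scales
the cumulants `κ_n ↦ c^n κ_n` — `𝓔ᵀ(cX; n) = c^n 𝓔ᵀ(X; n)`, the reason why `𝒢_r = κ_r(λV)/r!` carries exactly
the power `λ^r` in `𝒢 = Σ_r λ^r 𝒢_r` (render p0011:L143-L150). [cite: Salmhofer1998, §3.2 (render p0011:L143-L150)] -/
theorem cumulantOf_pow_mul {S : Type*} [CommRing S] (μ : ℕ → S) (hμ : μ 0 = 1) (c : S) {n : ℕ} (hn : n ≠ 0) :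
    cumulantOf (fun k => c ^ k * μ k) n = c ^ n * cumulantOf μ n := by
  obtain ⟨n, rfl⟩ := Nat.exists_eq_succ_of_ne_zero hn
  refine (eq_cumulantOf_of_recursion (fun k => c ^ k * μ k) (by rw [pow_zero, one_mul, hμ])
    (fun m => c ^ (m + 1) * cumulantOf μ (m + 1)) (fun m => ?_) n).symm
  rw [moment_succ_eq_sum_choose_mul_cumulantOf μ hμ m, mul_sum]
  refine sum_congr rfl fun k hk => ?_
  have hkm : k ≤ m := Nat.lt_succ_iff.1 (mem_range.1 hk)
  rw [show c ^ (m + 1) = c ^ (k + 1) * c ^ (m - k) by rw [← pow_add]; congr 1; omega]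
  ring

variable {𝕜 : Type*} [RCLike 𝕜] {Γ : Type*} [Fintype Γ]

/-- **`𝒢_r` is the coefficient of `λ^r`**: the order-`r` truncated expectation of the scaled interaction
`λW` is `λ^r` times that of `W`, `𝓔ᵀ_C(λW; r) = λ^r 𝓔ᵀ_C(W; r)` (so `Σ_r 𝓔ᵀ_C(λW; r)/r! = Σ_r λ^r 𝒢_r`,
render p0011:L143-L150). [cite: Salmhofer1998, §3.2 (render p0011:L143-L150)] -/
theorem cumulantOf_evenGaussConv_smul_pow (C : Matrix Γ Γ 𝕜) (W : evenPart 𝕜 Γ) (c : 𝕜) {r : ℕ} (hr : r ≠ 0) :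
    cumulantOf (fun k => evenGaussConv 𝕜 C ((c • W) ^ k)) r =
      c ^ r • cumulantOf (fun k => evenGaussConv 𝕜 C (W ^ k)) r := by
  have hμ0 : (fun k => evenGaussConv 𝕜 C (W ^ k)) 0 = 1 :=
    Subtype.ext (by simp only [pow_zero, coe_evenGaussConv, OneMemClass.coe_one, gaussConv_one])
  have h := cumulantOf_pow_mul (fun k => evenGaussConv 𝕜 C (W ^ k)) hμ0 (algebraMap 𝕜 (evenPart 𝕜 Γ) c) hr
  simp only [← map_pow, ← Algebra.smul_def] at h
  rw [← h]
  congr 1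
  funext k
  rw [smul_pow, map_smul]

/-- **Cumulants of a deterministic variable**: for the moment sequence `μ_k = W^k` (no integration),
`κ_1 = W` and `κ_r = 0` for `r ≥ 2` — the initial condition `𝒢(0,ψ) = λV` of the flow when `C_0 = 0`
(`e^{Δ_0} = 1`, render p0011:L46-L47). [cite: Salmhofer1998, §3.1 (render p0011:L46-L53)] -/
theorem cumulantOf_pow_self {S : Type*} [CommRing S] (W : S) (n : ℕ) :
    cumulantOf (fun k => W ^ k) (n + 1) = if n = 0 then W else 0 := by
  refine (eq_cumulantOf_of_recursion (fun k => W ^ k) (pow_zero W) (fun m => if m = 0 then W else 0)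
    (fun m => ?_) n).symm
  rw [sum_eq_single 0 (fun k _ hk => by rw [if_neg hk, mul_zero, zero_mul]) (fun h => absurd (mem_range.2
    (Nat.succ_pos m)) h), if_pos rfl, Nat.choose_zero_right, Nat.cast_one, one_mul, Nat.sub_zero, pow_succ']

/-- The same in the Grassmann setting: at a time `t₀` with `C_{t₀} = 0` the order-`r` effective actions are
`𝒢_1(t₀) = W` and `𝒢_r(t₀) = 0` for `r ≥ 2` (`𝒢(0,ψ) = λV`). [cite: Salmhofer1998, §3.1 (render p0011:L46-L53)] -/
theorem cumulantOf_evenGaussConv_zero (W : evenPart 𝕜 Γ) (n : ℕ) :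
    cumulantOf (fun k => evenGaussConv 𝕜 (0 : Matrix Γ Γ 𝕜) (W ^ k)) (n + 1) = if n = 0 then W else 0 := by
  have h : (fun k => evenGaussConv 𝕜 (0 : Matrix Γ Γ 𝕜) (W ^ k)) = fun k => W ^ k :=
    funext fun k => Subtype.ext (by rw [coe_evenGaussConv, gaussConv_zero, Module.End.one_apply])
  rw [h, cumulantOf_pow_self]

/-- **The first order does not flow after Wick ordering**: `𝒢_1(t) = e^{Δ_{C_t}} W` (`κ_1 = μ_1`), so its Wick
kernels with respect to `D_t = C_∞ - C_t` are the plain kernels of `e^{Δ_{C_∞}} W`, independent of `t` —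
consistent with `𝒬_{m,1} = 0` in Proposition 2 (render p0012:L69-L70). [cite: Salmhofer1998, §3.2 Prop. 2 (render p0012:L69-L70)] -/
theorem wickKernel_cumulantOf_one [DecidableEq Γ] (C Cinf : Matrix Γ Γ 𝕜) (W : evenPart 𝕜 Γ) (m : ℕ) (X : Fin m → Γ) :
    wickKernel 𝕜 (Cinf - C) ((cumulantOf (fun k => evenGaussConv 𝕜 C (W ^ k)) 1 : evenPart 𝕜 Γ) :
      GrassmannAlgebra 𝕜 Γ) m X = kernel 𝕜 (gaussConv 𝕜 Cinf (W : GrassmannAlgebra 𝕜 Γ)) m X := by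
  rw [cumulantOf_one, pow_one, coe_evenGaussConv, wickKernel_def, ← gaussConv_add_apply, sub_add_cancel]

end Homogeneity

section Assembly

variable {Γ : Type} [LinearOrder Γ] [Fintype Γ]

/-- **Salmhofer 1998, §3 end to end: the perturbative effective action solves the component RGE `\icomRGE`
in F7b's typed form.**  Let `t ↦ C_t` be an entrywise `C¹` covariance with continuous derivative `Ċ`,
`D_t = C_∞ - C_t` antisymmetric, `W ∈ ⋀^{even}` any even interaction, and
`𝒢_r(t) = (r!)⁻¹ 𝓔ᵀ_{C_t}(W; r)` (`r ≥ 1`, `𝒢_0 = 0`) the order-`r` effective action — the coefficient of `λ^r` in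
`𝒢(t,ψ) = log e^{Δ_{C_t}} e^{λW}` (p0011:L46-L53, L143-L150), `𝓔ᵀ_{C}(W; r) = cumulantOf (k ↦ e^{Δ_C} W^k) r` the truncated
expectations (whose kernels give the tree's `effAction` by `kernel_effAction_eq_neg_tsum`).  Then for every
`ε ≠ 0` the `ε`-scaled Wick-ordered (w.r.t. `D_t`) kernels
`G_{m,r}(t | X) = -ε^{-m} · wickKernel (C_∞ - C_t) (𝒢_r(t)) m X`
satisfy `IsRGESolution ε m̄ (C - C_∞) Ċ G` with `m̄(r) = |Γ|`: the RGE at order `λ^r` is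
`hasCoeffDerivAt_orderwise_effAction` (from the moment flow (Geffdif) and the moment–cumulant recursion), `Ċ` is
antisymmetric
(`transpose_dotCov_eq_neg`), every kernel of degree `m > |Γ|` vanishes (no injective field string), and
`isRGESolution_of_orderwise_rge` ((3.15) + (3.20) + (4.2) ⇒ (4.3)) concludes.  (The sharper support bound
`m̄(r) = 2r + 2` of the quartic model (p0011:L172) is the tree's `kernel_cumulantOf_eq_zero_of_degree_lt`;
F7b's theorems take any `m̄`.) [cite: Salmhofer1998, §3.1-3.2 and §4.1 (4.3) (render p0011:L46-L60, L143-L175; p0012:L38-L54, L152-L160; p0014:L44-L52)] -/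
theorem isRGESolution_orderwise_effAction
    (C : ℝ → Matrix Γ Γ ℂ) (Cdot : ℝ → Matrix Γ Γ ℂ) (Cinf : Matrix Γ Γ ℂ)
    (hC : ∀ (t : ℝ) (X Y : Γ), HasDerivAt (fun s => C s X Y) (Cdot t X Y) t)
    (hCdot : ∀ X Y : Γ, Continuous fun t => Cdot t X Y)
    (hanti : ∀ t : ℝ, (Cinf - C t).transpose = -(Cinf - C t)) (W : evenPart ℂ Γ)
    (𝒢 : ℕ → ℝ → GrassmannAlgebra ℂ Γ)
    (h𝒢 : ∀ r s, 𝒢 r s = if r = 0 then 0 else ((r ! : ℂ)⁻¹) •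
      ((cumulantOf (fun k => evenGaussConv ℂ (C s) (W ^ k)) r : evenPart ℂ Γ) : GrassmannAlgebra ℂ Γ))
    {ε : ℝ} (hε : ε ≠ 0) :
    IsRGESolution ε (fun _ => Fintype.card Γ) (fun t => C t - Cinf) Cdot
      (fun m r t X => -((ε⁻¹ ^ m : ℝ) : ℂ) * wickKernel ℂ (Cinf - C t) (𝒢 r t) m X) := by
  refine isRGESolution_of_orderwise_rge C Cdot Cinf hC hCdot hanti _ 𝒢 ?_ ?_ ?_ hε
  · intro r t
    rw [h𝒢]
    split_ifs
    · exact zero_mem _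
    · exact Submodule.smul_mem _ _ (Subtype.prop _)
  · intro r t
    exact hasCoeffDerivAt_orderwise_effAction (hC t) (transpose_dotCov_eq_neg C Cdot Cinf hC hanti t) W 𝒢 h𝒢 r
  · intro r t m X hm
    exact wickKernel_eq_zero_of_not_injective _ _ fun hX => by
      have h := Fintype.card_le_of_injective X hX
      rw [Fintype.card_fin] at h
      omega

end Assembly

end Salmhofer1998

end Literature.MathematicalPhysics.QuantumLattice.FermiRG
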